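/-
Copyright (c) 2026 the pub-hodgecm-mathlib formalisation cell (harness21).  Prover seat hodgecm-mathlib-K2Liu-p09 (g6): Track B «K2-LIT»,
hLiu418 = stmt-HodgeConjecture-24832; LEAD F0P6-plan RULING M-158d «A7-val road (σ)», file V1d (the flat family through a section; the Siegel law of the value).
-/
import Summits.HodgeConjecture.HodgeConjecture.Theorems.K2LiuA7ValueFunctional   -- ★ V1 (heights, `localSiegelCharacter_eq_cpow_mul`, `value_unique`; ★ B2, ★ Φ8a)
import HarnessLib

/-!
# Crux `HLiu418`, road `K2_Liu`, organ A7-val, file V1d: THE `K₀`-FLAT FAMILY THROUGH A SMOOTH SIEGEL SECTION EXISTS, AND THE (A4′-R) VALUE AT `½`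
# IS A SIEGEL SECTION OF `I_v(−½, χ′_v)`

Cell `hodgecm-mathlib`, crux item hLiu418 = `stmt-HodgeConjecture-24832`; squad K2 ∕ K2Liu; prover K2Liu-p09 (g6), organ lead A7-val.  THEOREMS ONLY; lane
`--supports stmt-HodgeConjecture-24832` (count-neutral helper).  RANK-GENERIC, frame-free, every finite place.
* §1 **`exists_flatFamily`** — for an Iwasawa compact `K₀ ≤ H_v` (compact open, `H_v = P_Δ K₀`) and a smooth Siegel section `φ ∈ I_v(s₁, χ_v)` there is a family
  `f : ℂ → H_v → ℂ` of smooth Siegel sections (`f s ∈ I_v(s, χ_v)`), FLAT on `K₀`, with `f s₁ = φ`: `f s x := |det_Δ p(x)|_v^{s − s₁} · φ x` along the Iwasawa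
  height of ★ V1 (well defined by ★ V1 `absDetDelta_eq_of_mul_eq_mul`).  This is the family the faces (A4′-R)∕(A4″-KR) quantify over; with ★ V1 it makes the value
  functional `φ ↦ Fn(½, ·)` defined on ALL smooth Siegel sections at `½`.
* §2 **`value_siegel_mul`** — the Siegel law of the value: if `Fn` is the (A4′-R) value of a family `f` of Siegel sections of `I_v(s, χ_v)` then
  `Fn(½) (p h) = χ′_{−½}(p) · Fn(½) h` for `p ∈ P_Δ(F_v)`, `χ′ = (χ ∘ c)⁻¹` — from ★ Φ8a `isLocalSiegelSection_localIntertwining_of_modulus` (`M_v(s) : I_v(s,χ) →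
  I_v(−s, χ′)`, GIVEN the modulus of `Ad(P_Δ)` on `N_Δ`, binder `hmod` = ★ `K2LiuUnipDeltaConjugationModulus`) on `1 < re s` and the identity principle ★ F1; the
  Laurent monomial `s ↦ χ′_{−s}(p)` is regular (§2 `isQRationalRegularAt_localSiegelCharacter_neg`).
HONEST LABEL.  `HC_CM` is proved only modulo the 7 printed citations (2 remaining named inputs: hLiu418 = `stmt-HodgeConjecture-24832`,
h413 = `stmt-HodgeConjecture-24833`) until rung 0 closes.

## References
* [KudlaSweet1997] S. Kudla, W. J. Sweet, Israel J. Math. 98 (1997), §1 (standard sections; `M(s) : I(s,χ) → I(−s, (χ∘c)⁻¹)`).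
* [Casselman1980] W. Casselman, Compositio Math. 40 (1980), §3.
* [HarrisKudlaSweet1996] M. Harris, S. Kudla, W. J. Sweet, J. AMS 9 (1996), §1 (1.11)–(1.15), §6 (6.14).
-/

set_option autoImplicit false
set_option linter.dupNamespace false -- the mandated namespace repeats `HodgeConjecture.HodgeConjecture`

noncomputable section

open scoped Classical NNReal ENNReal
open NumberField IsDedekindDomain MeasureTheory Topology
open Literature.NumberTheory.GaloisRepresentations Literature.NumberTheory.GaloisRepresentations.IsNonarchimedeanLocalField
open Literature.NumberTheory.Automorphic Literature.NumberTheory.Automorphic.UnitaryGroup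
open Literature.NumberTheory.GelbartRogawski1991.UnitaryDualPair.LocalSplitting
open Literature.NumberTheory.K2Lit.LocalSiegelDoubled
open Summit.HodgeConjecture.HodgeConjecture.Cruxes.HLiu418.K2LiuQRationalDefs
open Summit.HodgeConjecture.HodgeConjecture.Cruxes.HLiu418.K2LiuLocalLFactorDefs
open Summit.HodgeConjecture.HodgeConjecture.Cruxes.HLiu418.K2LiuLocalSiegel
open Summit.HodgeConjecture.HodgeConjecture.Cruxes.HLiu418.K2LiuLocalIntertwiningProperty
open Summit.HodgeConjecture.HodgeConjecture.Cruxes.HLiu418.K2LiuFlatSiegelFamilies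
open Summit.HodgeConjecture.HodgeConjecture.Cruxes.HLiu418.K2LiuA7ValueFunctional

namespace Summit.HodgeConjecture.HodgeConjecture.Cruxes.HLiu418.K2LiuA7ValueSiegelLaw

variable (F : Type) [Field F] [NumberField F] (E : Type) [Field E] [NumberField E] [Algebra F E]
  [Algebra.IsQuadraticExtension F E] (c : E ≃ₐ[F] E)
  {δ : E} (hcδ : c δ = -δ) (hδ : δ ≠ 0) {d : F} (hd : δ * δ = algebraMap F E d) (v : HeightOneSpectrum (𝓞 F)) (n : ℕ)
  {T₀ : Matrix (Fin n) (Fin n) F} (hT₀ : T₀.IsSymm) {JD : Matrix (Fin (n + n)) (Fin (n + n)) E} (hJD : JD = (gramD F n T₀).map (algebraMap F E))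
  (χv : ∀ w : PlacesOver E v, (w.1.adicCompletion E)ˣ →* ℂˣ)

/-! ## §1 The `K₀`-flat family through a smooth Siegel section -/

section Flat

include hcδ hδ hd hT₀ hJD in
/-- **THE `K₀`-FLAT FAMILY THROUGH A SMOOTH SIEGEL SECTION.**  `K₀ ≤ H_v` compact open with `H_v = P_Δ(F_v)·K₀`, `φ ∈ I_v(s₁, χ_v)` smooth: there is
`f : ℂ → H_v → ℂ` with every `f s` a smooth Siegel section of `I_v(s, χ_v)`, `f` flat on `K₀`, and `f s₁ = φ` — namely `f s x = |det_Δ p(x)|_v^{s−s₁} · φ x`.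
[cite: KudlaSweet1997, §1] [cite: Casselman1980, §3] -/
theorem exists_flatFamily (K₀ : Subgroup (UnitaryGroup.localPi E c (n + n) JD v))
    (hK₀ : IsCompact (K₀ : Set (UnitaryGroup.localPi E c (n + n) JD v)) ∧ IsOpen (K₀ : Set (UnitaryGroup.localPi E c (n + n) JD v)))
    (hIw : ∀ x : UnitaryGroup.localPi E c (n + n) JD v, ∃ p, IsSiegelDelta F E c hcδ hδ hd v n hT₀ hJD p ∧ ∃ k ∈ K₀, x = p * k)
    (s₁ : ℂ) {φ : UnitaryGroup.localPi E c (n + n) JD v → ℂ} (hφ : IsLocalSiegelSection F E c hcδ hδ hd v n hT₀ hJD χv s₁ φ) (hφsm : IsSmooth F E c v n φ) :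
    ∃ f : ℂ → UnitaryGroup.localPi E c (n + n) JD v → ℂ,
      (∀ s, IsLocalSiegelSection F E c hcδ hδ hd v n hT₀ hJD χv s (f s)) ∧ (∀ s, IsSmooth F E c v n (f s)) ∧
        (∀ s s' : ℂ, ∀ k ∈ K₀, f s k = f s' k) ∧ f s₁ = φ := by
  choose pI hpI kI hkI hxI using hIw
  have hν_left : ∀ (p x : UnitaryGroup.localPi E c (n + n) JD v), IsSiegelDelta F E c hcδ hδ hd v n hT₀ hJD p →
      absDetDelta F E c v n (pI (p * x)) = absDetDelta F E c v n p * absDetDelta F E c v n (pI x) := fun p x hp => by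
    rw [← absDetDelta_mul F E c hcδ hδ hd v n hT₀ hJD p (pI x) (hpI x)]
    exact absDetDelta_eq_of_mul_eq_mul F E c hcδ hδ hd v n hT₀ hJD K₀ hK₀.1 (hpI _) (hp.mul (hpI x)) (hkI _) (hkI x)
      (by rw [← hxI (p * x), mul_assoc, ← hxI x])
  have hν_right : ∀ (x k : UnitaryGroup.localPi E c (n + n) JD v), k ∈ K₀ →
      absDetDelta F E c v n (pI (x * k)) = absDetDelta F E c v n (pI x) := fun x k hk =>
    absDetDelta_eq_of_mul_eq_mul F E c hcδ hδ hd v n hT₀ hJD K₀ hK₀.1 (hpI _) (hpI x) (hkI _) (K₀.mul_mem (hkI x) hk)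
      (by rw [← hxI (x * k), ← mul_assoc, ← hxI x])
  have hν_one : ∀ k : UnitaryGroup.localPi E c (n + n) JD v, k ∈ K₀ → absDetDelta F E c v n (pI k) = 1 := fun k hk => by
    have h := hν_right 1 k hk
    rw [one_mul] at h
    rw [h]
    have h1 := absDetDelta_eq_of_mul_eq_mul F E c hcδ hδ hd v n hT₀ hJD K₀ hK₀.1 (hpI 1) (isSiegelDelta_one F E c hcδ hδ hd v n hT₀ hJD) (hkI 1) K₀.one_mem
      (by rw [← hxI 1, one_mul])
    rw [h1, absDetDelta_one]
  obtain ⟨U, hU⟩ := hφsm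
  refine ⟨fun s x => ((absDetDelta F E c v n (pI x) : ℝ) : ℂ) ^ (s - s₁) * φ x, fun s p hp x => ?_, fun s => ?_, fun s s' k hk => ?_, ?_⟩
  · -- Siegel
    show ((absDetDelta F E c v n (pI (p * x)) : ℝ) : ℂ) ^ (s - s₁) * φ (p * x) = localSiegelCharacter F E c v n χv s p * (((absDetDelta F E c v n (pI x) : ℝ) : ℂ) ^ (s - s₁) * φ x)
    rw [hν_left p x hp, hφ p hp x, Complex.ofReal_mul, Complex.mul_cpow_ofReal_nonneg (absDetDelta_nonneg F E c v n p) (absDetDelta_nonneg F E c v n _),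
      localSiegelCharacter_eq_cpow_mul F E c hcδ hδ hd v n hT₀ hJD χv hp s s₁]
    ring
  · -- smooth
    refine ⟨⟨K₀, hK₀.2⟩ ⊓ U, fun x u hu => ?_⟩
    have hu' : u ∈ K₀ ∧ u ∈ (U : Subgroup _) := by simpa [OpenSubgroup.coe_inf] using hu
    show ((absDetDelta F E c v n (pI (x * u)) : ℝ) : ℂ) ^ (s - s₁) * φ (x * u) = ((absDetDelta F E c v n (pI x) : ℝ) : ℂ) ^ (s - s₁) * φ x
    rw [hν_right x u hu'.1, hU x u hu'.2]
  · -- flat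
    show ((absDetDelta F E c v n (pI k) : ℝ) : ℂ) ^ (s - s₁) * φ k = ((absDetDelta F E c v n (pI k) : ℝ) : ℂ) ^ (s' - s₁) * φ k
    rw [hν_one k hk, Complex.ofReal_one, Complex.one_cpow, Complex.one_cpow]
  · funext x
    show ((absDetDelta F E c v n (pI x) : ℝ) : ℂ) ^ (s₁ - s₁) * φ x = φ x
    rw [sub_self, Complex.cpow_zero, one_mul]

end Flat

/-! ## §2 The value at `½` is a Siegel section of `I_v(−½, χ′_v)` -/

section Siegel

variable {q : ℕ}

/-- `s ↦ ((a : ℝ) : ℂ)^(−s + c₀)` is `q`-rational and regular everywhere for `a = q^K` (`= (q^{−K})^{s − c₀}`). [cite: Casselman1980, §3] -/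
theorem isQRationalRegularAt_zpow_cpow_neg_add (hq : q ≠ 0) (K : ℤ) (c₀ s₀ : ℂ) :
    IsQRationalRegularAt q s₀ fun s => (((q : ℝ) ^ K : ℝ) : ℂ) ^ (-s + c₀) := by
  have hq0 : (0 : ℝ) < q := by exact_mod_cast Nat.pos_of_ne_zero hq
  refine (isQRationalRegularAt_zpow_cpow_add hq (-K) (-c₀) s₀).congr fun s => ?_
  have hpos : (0 : ℝ) < (q : ℝ) ^ K := zpow_pos hq0 K
  have harg : (((q : ℝ) ^ K : ℝ) : ℂ).arg ≠ Real.pi := by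
    rw [Complex.arg_ofReal_of_nonneg hpos.le]; exact Real.pi_ne_zero.symm
  rw [zpow_neg, Complex.ofReal_inv, Complex.inv_cpow _ _ harg, ← Complex.cpow_neg]
  congr 1
  ring

variable [MeasurableSpace (unipDeltaLocal F E c v n (JD := JD))] [BorelSpace (unipDeltaLocal F E c v n (JD := JD))]
  (νN : Measure (unipDeltaLocal F E c v n (JD := JD))) [νN.IsMulLeftInvariant]
  (hmod : ∀ (q' : UnitaryGroup.localPi E c (n + n) JD v) (hq : IsSiegelDelta F E c hcδ hδ hd v n hT₀ hJD q'),
    Measure.map (fun u : unipDeltaLocal F E c v n (JD := JD) =>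
      (⟨q' * (u : UnitaryGroup.localPi E c (n + n) JD v) * q'⁻¹, conj_mem_unipDeltaLocal F E c hcδ hδ hd v n hT₀ hJD hq u.2⟩ :
        unipDeltaLocal F E c v n (JD := JD))) νN =
      ENNReal.ofReal ((absDetDelta F E c v n q' ^ n)⁻¹) • νN)
  (χv' : ∀ w : PlacesOver E v, (w.1.adicCompletion E)ˣ →* ℂˣ)
  (hχ' : ∀ (w w' : PlacesOver E v) (h : c • w.1 = w'.1),
    χv' w = (χv w')⁻¹.comp (Units.map (galAdicCompletionMap (L := E) c h : w.1.adicCompletion E →* w'.1.adicCompletion E)))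
  (vol : ℝ) (haN : ∀ s : ℂ, 1 < s.re → aNorm F E c v n χv vol s ≠ 0) (hT₀d : IsUnit T₀.det)

include hcδ hδ hd hT₀ hJD hmod hχ' haN hT₀d in
/-- **THE SIEGEL LAW OF THE VALUE AT `½`.**  For a family `f` of Siegel sections `f s ∈ I_v(s, χ_v)` with (A4′-R) value `Fn` (`M_v(s)(f s) h = aNorm(s) · Fn s h` on
`1 < re s`, `Fn(·) h` regular at `½`), and `p ∈ P_Δ(F_v)`: **`Fn(½) (p h) = χ′_{−½}(p) · Fn(½) h`**, `χ′ = (χ ∘ c)⁻¹` — so the value function `Fn(½, ·)` is a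
Siegel section of `I_v(−½, χ′_v)`.  From ★ Φ8a (`M_v(s)` intertwines into `I_v(−s, χ′)`, given the modulus `hmod` of `Ad(P_Δ)` on `N_Δ`) on the half-plane and
the identity principle ★ F1. [cite: KudlaSweet1997, §1] [cite: Casselman1980, §3] [cite: HarrisKudlaSweet1996, §1 (1.15)] -/
theorem value_siegel_mul {f : ℂ → UnitaryGroup.localPi E c (n + n) JD v → ℂ} (hSieg : ∀ s, IsLocalSiegelSection F E c hcδ hδ hd v n hT₀ hJD χv s (f s))
    {Fn : ℂ → UnitaryGroup.localPi E c (n + n) JD v → ℂ} (hFn_reg : ∀ h, IsQRationalRegularAt (residueFieldCard (v.adicCompletion F)) (1 / 2) fun s => Fn s h)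
    (hFn : ∀ s : ℂ, 1 < s.re → ∀ h, localIntertwining F E c v n hJD νN (f s) h = aNorm F E c v n χv vol s * Fn s h)
    {p : UnitaryGroup.localPi E c (n + n) JD v} (hp : IsSiegelDelta F E c hcδ hδ hd v n hT₀ hJD p) (h : UnitaryGroup.localPi E c (n + n) JD v) :
    Fn (1 / 2) (p * h) = localSiegelCharacter F E c v n χv' (-(1 / 2)) p * Fn (1 / 2) h := by
  -- both sides are rational and regular at `½`; they agree on `1 < re s` by ★ Φ8a
  have hreg : IsQRationalRegularAt (residueFieldCard (v.adicCompletion F)) (1 / 2) fun s => localSiegelCharacter F E c v n χv' (-s) p * Fn s h := by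
    obtain ⟨K, hK⟩ := exists_absDetDelta_eq_zpow F E c hcδ hδ hd v n hT₀ hJD hp
    refine ((isQRationalRegularAt_zpow_cpow_neg_add (residueFieldCard_ne_zero (v.adicCompletion F)) K ((n : ℂ) / 2) (1 / 2)).const_mul
      ((chiDet F E c v n χv' p : ℂˣ) : ℂ)).mul (hFn_reg h) |>.congr fun s => ?_
    simp only [localSiegelCharacter, hK]
  refine IsQRationalRegularAt.eq_of_eqOn_halfPlane (two_le_residueFieldCard F v) (hFn_reg (p * h)) hreg 1 fun s hs => ?_
  have hM := isLocalSiegelSection_localIntertwining_of_modulus F E c hcδ hδ hd v n hT₀ hT₀d hJD νN hmod χv χv' hχ' s (hSieg s) p hp h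
  rw [hFn s hs, hFn s hs] at hM
  have := mul_left_cancel₀ (haN s hs) (by rw [hM]; ring : aNorm F E c v n χv vol s * Fn s (p * h) = aNorm F E c v n χv vol s * (localSiegelCharacter F E c v n χv' (-s) p * Fn s h))
  exact this

end Siegel

end Summit.HodgeConjecture.HodgeConjecture.Cruxes.HLiu418.K2LiuA7ValueSiegelLaw

end
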